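import Literature.NumberTheory.ConnesConsani2021.ArchimedeanTraceFormulaProofs
import Literature.Analysis.Convolution.DixmierMalliavinHolds
import Literature.NumberTheory.ConnesConsani2021.CosineTailEnergy
import HarnessLib

/-!
# Connes–Consani 2021, Theorem 4.7 (strong form, as printed) from Proposition 2.2 (iii) alone

A. Connes, C. Consani, *Weil positivity and trace formula, the archimedean place*, Selecta Math.
(N.S.) 27 (2021), Paper No. 77 = arXiv:2006.13771 [bib: `ConnesConsani2021`], §4 Thm. 4.7 (= arXiv
Thm. 27, §4 p. 18): for every Hilbert basis `(b_i)` of the Sonin space `S(1,1)` and every test function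
`F`, `Σ_i ⟨b_i | ϑ(F) b_i⟩ = W_∞(F) + ∫ F(x) ε(x) d*x` (trace formula, (i)), and the functional
`W_∞ + ε` is positive on `F ∗ F̃` ((ii)).  The tree's `ArchimedeanTraceFormulaProofs.lean` proves the
strong statement `CC2021_thm_4_7` from `CC2021_prop_2_2_iii` and the Dixmier–Malliavin factorization
of test functions (`CC2021_thm_4_7_of_dixmierMalliavin`); the latter is now a tree theorem
(`Literature.Analysis.Convolution.DixmierMalliavin_real_holds`, `DixmierMalliavinHolds.lean`).  This file
records the resulting one-hypothesis form.  It is kept separate from `ArchimedeanTraceFormulaProofs.lean`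
so that the K1 consumers of that file do not acquire the Dixmier–Malliavin modules as dependencies.

RH-context: `CC2021_thm_4_7` is the OFF-PATH strong form (the K1 leaf `SoninTraceFormula` uses only
`CC2021_thm_4_7_weak`); RH-FREE corpus literature; nothing here bears on the truth of RH.

## References
* A. Connes, C. Consani, *Weil positivity and trace formula, the archimedean place*, Selecta Math.
  (N.S.) 27 (2021) 77 = arXiv:2006.13771, §4 Thm. 4.7 (= arXiv Thm. 27, p. 18). [ConnesConsani2021]
* J. Dixmier, P. Malliavin, Bull. Sci. Math. (2) 102 (1978) 305–330, Thm. 3.1. [DixmierMalliavin1978]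
-/

noncomputable section

namespace Literature.NumberTheory.ConnesConsani2021

/-- **CC2021 Thm. 4.7 (strong form) from Prop. 2.2 (iii) alone**: the Dixmier–Malliavin input of
`CC2021_thm_4_7_of_dixmierMalliavin` is discharged by
`Literature.Analysis.Convolution.DixmierMalliavin_real_holds`.
[cite: ConnesConsani2021, Thm. 4.7 §4 p. 18 (arXiv Thm. 27, chunk p0018:L33–40)] -/
theorem CC2021_thm_4_7_of_prop_2_2_iii (h₂ : CC2021_prop_2_2_iii) : CC2021_thm_4_7 :=
  CC2021_thm_4_7_of_dixmierMalliavin Literature.Analysis.Convolution.DixmierMalliavin_real_holds h₂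

/-- **CC2021 Thm. 4.7 (strong form, as printed), DISCHARGED**: for every Hilbert basis `(b_i)` of the
Sonin space `S(1,1)` and every test function `F`, `Σ_i ⟨b_i | ϑ(F) b_i⟩ = W_∞(F) + ∫F(x)ε(x)d*x`, and
`W_∞ + ε ≥ 0` on `F ∗ F̃` — hypothesis-free: Prop. 2.2 (iii) is the tree theorem
`CC2021_prop_2_2_iii_holds` (`CosineTailEnergy.lean`: the cosine-tail energy identity, seats
gm-t15/gm-t13/t1/t18), and Dixmier–Malliavin is `DixmierMalliavin_real_holds` (seats t4/t14/t11).
(Appended under seat t4 g2's authorization, cc/STATUS 2026-08-26T11:34:39Z.)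
[cite: ConnesConsani2021, Thm. 4.7 §4 p. 18 (arXiv Thm. 27, chunk p0018:L33–40)] -/
theorem CC2021_thm_4_7_holds : CC2021_thm_4_7 :=
  CC2021_thm_4_7_of_prop_2_2_iii CC2021_prop_2_2_iii_holds

end Literature.NumberTheory.ConnesConsani2021
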